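import Literature.NumberTheory.DiophantineApproximation.DilogLinearIndependence
import HarnessLib

/-!
# Small integer forms force linear independence (reduction to the transference lemma)

Topic `Literature/NumberTheory/DiophantineApproximation`. The REDUCTION half of the
Nesterenko-type independence criterion used by the every-weight Hermite–Padé programme
(`PolylogLinearIndependence.lean`): let `θ₁, …, θ_w` be real numbers and suppose there are
integer forms `ℓ_n = p_n + ∑_j q_{n,j} θ_j` with, eventually,
`e^{−A₁ n} ≤ |ℓ_n| ≤ e^{−A₂ n}` and `|q_{n,j}| ≤ e^{B n}`, where `0 < A₂ ≤ A₁`, `0 ≤ B` and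

  `(w − 1) B < A₂`,   `(w − 1)(A₁ + B) < w A₂`.

Then `1, θ₁, …, θ_w` are linearly independent over `ℚ`: every integer relation
`c₀ + ∑ c_j θ_j = 0` is trivial (`relation_trivial_of_small_forms`). Proof: if `c_{j₀} ≠ 0`,
eliminating `θ_{j₀}` turns `c_{j₀} ℓ_n` into integer forms in the remaining `w − 1` numbers with
the same rates up to an arbitrarily small `ε` (constants `|c_{j₀}|`, `∑|c_j|` are absorbed), and
the `(w−1)`-dimensional two-rate transference lemma `no_integer_forms`
(`IntegerFormsTransference.lean`) says such forms do not exist. For `w = 2` this is how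
`DilogLinearIndependence.lean` argued by hand. This file takes the transference lemma as an
explicit hypothesis `hT` (its statement verbatim, no auxiliary definition), so that it does not
depend on the order in which the sibling files land; `PolylogLinearIndependence.lean` instantiates `hT`
with `no_integer_forms`.

References: Yu. V. Nesterenko, Vestnik Moskov. Univ. (1985) (the criterion); S. Fischler,
W. Zudilin, Math. Ann. 347 (2010) (refinement; reduction to a basis).
-/

noncomputable section

open Finset Filter Real

namespace Literature.NumberTheory.DiophantineApproximation

open _root_.Filter _root_.Topology

/-- **Small forms force independence** (reduction step of Nesterenko's criterion, two-rate form):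
given integer forms `p_n + ∑_j q_{n,j} θ_j` in `θ : Fin (k+1) → ℝ` with eventually
`e^{−A₁n} ≤ |ℓ_n| ≤ e^{−A₂n}`, `|q_{n,j}| ≤ e^{Bn}`, `0 < A₂ ≤ A₁`, `0 ≤ B`, `k B < A₂` and
`k (A₁ + B) < (k+1) A₂`, and given the `k`-dimensional transference lemma `hT`, every integer
relation `c₀ + ∑_j c_{j+1} θ_j = 0` is trivial. The hypothesis `hT` is verbatim the statement of
`no_integer_forms` (`IntegerFormsTransference.lean`) in dimension `k`. [folklore] -/
theorem relation_trivial_of_small_forms {k : ℕ}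
    (hT : (∀ (ξ : Fin k → ℝ) (A₁ A₂ B : ℝ), 0 < A₂ → A₂ ≤ A₁ → 0 ≤ B →
      (k : ℝ) * B < A₂ → (k : ℝ) * (A₁ + B) < ((k : ℝ) + 1) * A₂ →
      ∀ (P : ℕ → ℤ) (Q : ℕ → Fin k → ℤ),
        (∀ᶠ n : ℕ in atTop, Real.exp (-(A₁ * n)) ≤ |(P n : ℝ) + ∑ i, (Q n i : ℝ) * ξ i|) →
        (∀ᶠ n : ℕ in atTop, |(P n : ℝ) + ∑ i, (Q n i : ℝ) * ξ i| ≤ Real.exp (-(A₂ * n))) →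
        (∀ᶠ n : ℕ in atTop, ∀ i, |(Q n i : ℝ)| ≤ Real.exp (B * n)) → False))
    (θ : Fin (k + 1) → ℝ)
    {A₁ A₂ B : ℝ} (hA₂ : 0 < A₂) (hA : A₂ ≤ A₁) (hB : 0 ≤ B)
    (hgap₁ : (k : ℝ) * B < A₂) (hgap₂ : (k : ℝ) * (A₁ + B) < ((k : ℝ) + 1) * A₂)
    (p : ℕ → ℤ) (q : ℕ → Fin (k + 1) → ℤ)
    (hlow : ∀ᶠ n : ℕ in atTop, Real.exp (-(A₁ * n)) ≤ |(p n : ℝ) + ∑ j, (q n j : ℝ) * θ j|)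
    (hup : ∀ᶠ n : ℕ in atTop, |(p n : ℝ) + ∑ j, (q n j : ℝ) * θ j| ≤ Real.exp (-(A₂ * n)))
    (hq : ∀ᶠ n : ℕ in atTop, ∀ j, |(q n j : ℝ)| ≤ Real.exp (B * n))
    (c : Fin (k + 2) → ℤ) (hc : (c 0 : ℝ) + ∑ j : Fin (k + 1), (c j.succ : ℝ) * θ j = 0) :
    c = 0 := by
  by_contra hc0
  -- some coefficient of a `θ_j` is nonzero
  obtain ⟨j₀, hj₀⟩ : ∃ j₀ : Fin (k + 1), c j₀.succ ≠ 0 := by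
    by_contra hall
    push Not at hall
    apply hc0
    have h0 : c 0 = 0 := by
      have : (c 0 : ℝ) = 0 := by
        have hsum : ∑ j : Fin (k + 1), (c j.succ : ℝ) * θ j = 0 :=
          Finset.sum_eq_zero fun j _ => by rw [hall j, Int.cast_zero, zero_mul]
        rw [hsum, add_zero] at hc
        exact hc
      exact_mod_cast this
    funext j
    refine Fin.cases ?_ (fun j => ?_) j
    · simpa using h0
    · simpa using hall j
  -- the remaining numbers and the new forms
  set ξ : Fin k → ℝ := fun i => θ (j₀.succAbove i) with hξ
  set a : ℤ := c j₀.succ with ha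
  set P : ℕ → ℤ := fun n => a * p n - q n j₀ * c 0 with hP
  set Q : ℕ → Fin k → ℤ := fun n i => a * q n (j₀.succAbove i) - q n j₀ * c (j₀.succAbove i).succ
    with hQ
  -- the key identity `P_n + Σ Q_{n,i} ξ_i = a · ℓ_n`
  have hθ₀ : (a : ℝ) * θ j₀ = -(c 0 : ℝ) - ∑ i : Fin k, (c (j₀.succAbove i).succ : ℝ) * ξ i := by
    rw [Fin.sum_univ_succAbove _ j₀] at hc
    simp only [hξ, ha]
    linarith
  have hkey : ∀ n, (P n : ℝ) + ∑ i, (Q n i : ℝ) * ξ i =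
      a * ((p n : ℝ) + ∑ j, (q n j : ℝ) * θ j) := by
    intro n
    have hsplit : ∑ j, (q n j : ℝ) * θ j =
        (q n j₀ : ℝ) * θ j₀ + ∑ i : Fin k, (q n (j₀.succAbove i) : ℝ) * ξ i := by
      rw [Fin.sum_univ_succAbove _ j₀]
    have hL : (P n : ℝ) + ∑ i, (Q n i : ℝ) * ξ i =
        ((a : ℝ) * p n - (q n j₀ : ℝ) * c 0) +
          ((a : ℝ) * ∑ i : Fin k, (q n (j₀.succAbove i) : ℝ) * ξ i -
            (q n j₀ : ℝ) * ∑ i : Fin k, (c (j₀.succAbove i).succ : ℝ) * ξ i) := by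
      simp only [hP, hQ, Int.cast_sub, Int.cast_mul]
      congr 1
      rw [Finset.mul_sum, Finset.mul_sum, ← Finset.sum_sub_distrib]
      exact Finset.sum_congr rfl fun i _ => by ring
    rw [hL, hsplit]
    linear_combination (-(q n j₀ : ℝ)) * hθ₀
  -- sizes of the constants
  have ha1 : (1 : ℝ) ≤ |(a : ℝ)| := by exact_mod_cast Int.one_le_abs hj₀
  set K₀ : ℝ := |(a : ℝ)| + ∑ j : Fin (k + 2), |(c j : ℝ)| with hK₀
  have hK₀a : |(a : ℝ)| ≤ K₀ := by
    simp only [hK₀]; linarith [Finset.sum_nonneg fun j (_ : j ∈ (univ : Finset (Fin (k+2)))) =>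
      abs_nonneg (c j : ℝ)]
  have hcj : ∀ j : Fin (k + 2), |(c j : ℝ)| ≤ K₀ := by
    intro j
    have := Finset.single_le_sum (fun j (_ : j ∈ (univ : Finset (Fin (k+2)))) =>
      abs_nonneg (c j : ℝ)) (mem_univ j)
    simp only [hK₀]; linarith [abs_nonneg (a : ℝ)]
  have hK₀1 : (1 : ℝ) ≤ K₀ := ha1.trans hK₀a
  -- the slack `ε`
  have hs₁ : 0 < A₂ - k * B := by linarith
  have hs₂ : 0 < (k + 1) * A₂ - k * (A₁ + B) := by linarith
  obtain ⟨ε, hε, hεA, hε₁, hε₂⟩ : ∃ ε : ℝ, 0 < ε ∧ ε < A₂ ∧ (k + 1) * ε < A₂ - k * B ∧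
      (2 * k + 1) * ε < (k + 1) * A₂ - k * (A₁ + B) := by
    set s : ℝ := min A₂ (min (A₂ - k * B) ((k + 1) * A₂ - k * (A₁ + B))) with hs
    have hspos : 0 < s := lt_min hA₂ (lt_min hs₁ hs₂)
    have hsA : s ≤ A₂ := min_le_left _ _
    have hs1 : s ≤ A₂ - k * B := (min_le_right _ _).trans (min_le_left _ _)
    have hs2 : s ≤ (k + 1) * A₂ - k * (A₁ + B) := (min_le_right _ _).trans (min_le_right _ _)
    have hk0 : (0 : ℝ) ≤ k := by positivity
    have hden : (0 : ℝ) < 2 * k + 3 := by positivity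
    refine ⟨s / (2 * k + 3), div_pos hspos hden, ?_, ?_, ?_⟩
    · rw [div_lt_iff₀ hden]; nlinarith
    · rw [mul_div_assoc', div_lt_iff₀ hden]; nlinarith
    · rw [mul_div_assoc', div_lt_iff₀ hden]; nlinarith
  -- the transference lemma in dimension `k` with rates `A₁`, `A₂ − ε`, `B + ε`
  refine hT ξ A₁ (A₂ - ε) (B + ε) (by linarith) (by linarith) (by linarith) (by nlinarith)
    (by nlinarith) P Q ?_ ?_ ?_
  · -- lower bound: `|a ℓ_n| ≥ |ℓ_n|`
    filter_upwards [hlow] with n hn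
    rw [hkey n, abs_mul]
    exact hn.trans (le_mul_of_one_le_left (abs_nonneg _) ha1)
  · -- upper bound: `|a| e^{-A₂ n} ≤ e^{-(A₂ - ε) n}` eventually
    filter_upwards [hup, DilogPade.eventually_const_le_exp_mul K₀ hε] with n hn hK
    rw [hkey n, abs_mul]
    calc |(a : ℝ)| * |(p n : ℝ) + ∑ j, (q n j : ℝ) * θ j| ≤ K₀ * Real.exp (-(A₂ * n)) :=
          mul_le_mul hK₀a hn (abs_nonneg _) (by linarith)
      _ ≤ Real.exp (ε * n) * Real.exp (-(A₂ * n)) :=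
          mul_le_mul_of_nonneg_right hK (Real.exp_pos _).le
      _ = Real.exp (-((A₂ - ε) * n)) := by rw [← Real.exp_add]; ring_nf
  · -- coefficients: `|Q_{n,i}| ≤ 2 K₀ e^{B n} ≤ e^{(B+ε) n}` eventually
    filter_upwards [hq, DilogPade.eventually_const_le_exp_mul (2 * K₀) hε] with n hn hK i
    have h1 : |(a : ℝ) * (q n (j₀.succAbove i) : ℝ)| ≤ K₀ * Real.exp (B * n) := by
      rw [abs_mul]; exact mul_le_mul hK₀a (hn _) (abs_nonneg _) (by linarith)
    have h2 : |(q n j₀ : ℝ) * (c (j₀.succAbove i).succ : ℝ)| ≤ Real.exp (B * n) * K₀ := by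
      rw [abs_mul]; exact mul_le_mul (hn _) (hcj _) (abs_nonneg _) (Real.exp_pos _).le
    simp only [hQ]
    push_cast
    calc |(a : ℝ) * (q n (j₀.succAbove i) : ℝ) - (q n j₀ : ℝ) * (c (j₀.succAbove i).succ : ℝ)|
        ≤ |(a : ℝ) * (q n (j₀.succAbove i) : ℝ)| + |(q n j₀ : ℝ) * (c (j₀.succAbove i).succ : ℝ)| :=
          abs_sub _ _
      _ ≤ 2 * K₀ * Real.exp (B * n) := by linarith
      _ ≤ Real.exp (ε * n) * Real.exp (B * n) :=
          mul_le_mul_of_nonneg_right hK (Real.exp_pos _).le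
      _ = Real.exp ((B + ε) * n) := by rw [← Real.exp_add]; ring_nf

end Literature.NumberTheory.DiophantineApproximation
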